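import Summits.PneNP.PneNP.Theorems.ConvexRankGatesLinAlgGateBlindChainCover

/-!
# Route ConvexRankGates, crux `LinAlgGateBlind` (stmt-PneNP-10681): SG_PERM at logarithmic atom width — all `PERM_d` with `d log₂ d ≤ m^{7/8}/(log₂ m)^5`

Support theorems for the crux (vocabulary of `Theorems/ConvexRankGatesLinAlgGateBlindDefs.lean`). The chain cover
`sgAt_perm_of_chain_budget` (`…ChainCover`) proves `SG_PERM` for a `PERM_d` gate from the positive budget
`(ν C(l,2))^t C(m-t,k-t) ≤ ε C(m,k)` (`2t ≤ l`) of the planting tree and the cover budget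
`#𝒱(l)^{⌊log₂ d!⌋} (1/2)^{ν+1} #𝒱(l) < ε` of the union bound over subgroup chains; at the line's width `l = lOf m ≈ m^{1/16}`
this gives `d log₂ d ≤ m^{11/16}/(8 log₂ m)` (`sgAt_perm_of_dim_le_rpow`). Both budgets IMPROVE when the width shrinks
(`ν ≈ m/(k l²)`; covers are indexed by `≤ l`-sets). At the LOGARITHMIC width `L(c,m) = (2c+8)(⌊log₂ m⌋+1)`
(`t = L/2 = (c+4)(⌊log₂ m⌋+1)`, `(1/2)^t ≤ m^{-(c+4)} ≤ ε`) the admissible fragility is `ν = ⌊m/(2 k C(L,2))⌋ ≈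
m^{7/8}/((2c+8)² log₂² m)`, whence:

* `sgAt_perm_logWidth_of_natBudget` — the pointwise statement with both budgets as natural-number inequalities;
* `logWidth_le_lOf` / `logWidthPerm_regime` — `L(c,m) ≤ lOf m` and the analytic conversion of the budgets, eventually;
* `sgAt_perm_logWidth` — **SG_PERM at width `L(c,m)` for ALL `PERM_d` with `d · log₂ d ≤ m^{7/8}/(log₂ m)^5`**, at every
  level `c`, eventually in `m` (range `m^{11/16-o(1)} → m^{7/8-o(1)}`, nonabelian gates included);
* `sgAt_perm_logWidth_of_le_rpow` — in particular for all `d ≤ m^{3/4}`.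

With the level-`l` door theorem (`not_computes_clique_of_collapse_level`, `…LevelHost`) this yields the unconditional circuit
lower bound for `{∧₂, ∨₂} ∪ PERM_d`, `d log₂ d ≤ m^{7/8}/(log₂ m)^5`. The exponent `7/8 = 1 - δ` (`δ = 1/8`) is the limit of
every union-bound cover (`ν l² < m/k`). Sources: Razborov 1985, Alon–Boppana 1987 §3; the planting theorem and chain cover are
the tree's. No new definitions. [folklore]
-/

-- `Summit.PneNP.PneNP.…` duplicates `PneNP` BY DESIGN (single-problem summit).
set_option linter.dupNamespace false

noncomputable section

namespace Summit.PneNP.PneNP.Theorems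

open Finset Filter Literature.Computability.Complexity Razborov
open Summit.PneNP.PneNP.Cruxes.LinAlgGateBlind.DnfInvariantWideGatesSeeSmallCliques
open Summit.PneNP.PneNP.Cruxes.LinAlgGateBlind.DnfInvariantWideGatesSeeSmallCliques.DenseRegime
open Summit.PneNP.PneNP.Cruxes.LinAlgGateBlind.DnfInvariantWideGatesSeeSmallCliques.PermSmallDim

/-! ### The pointwise statement at width `L(c,m) = (2c+8)(⌊log₂ m⌋ + 1)` -/

/-- `4 m^{c+1} ≤ 2^{(c+4)(⌊log₂ m⌋+1)}` (`m < 2^{⌊log₂ m⌋+1}`, `4 ≤ 2^{3(⌊log₂ m⌋+1)}`). [folklore] -/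
theorem four_mul_pow_le_two_pow_logWidth (c m : ℕ) :
    4 * m ^ (c + 1) ≤ 2 ^ ((c + 4) * (Nat.log 2 m + 1)) := by
  have h : m ≤ 2 ^ (Nat.log 2 m + 1) := (Nat.lt_pow_succ_log_self one_lt_two m).le
  have h2 : 2 ≤ 2 ^ (Nat.log 2 m + 1) := by
    calc 2 = 2 ^ 1 := rfl
      _ ≤ 2 ^ (Nat.log 2 m + 1) := Nat.pow_le_pow_right two_pos (by omega)
  calc 4 * m ^ (c + 1) ≤ 2 ^ 3 * (2 ^ (Nat.log 2 m + 1)) ^ (c + 1) :=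
        Nat.mul_le_mul (by norm_num) (Nat.pow_le_pow_left h _)
    _ ≤ (2 ^ (Nat.log 2 m + 1)) ^ 3 * (2 ^ (Nat.log 2 m + 1)) ^ (c + 1) :=
        Nat.mul_le_mul_right _ (Nat.pow_le_pow_left h2 3)
    _ = 2 ^ ((c + 4) * (Nat.log 2 m + 1)) := by
        rw [← pow_add, ← pow_mul]
        congr 1
        ring

/-- `#𝒱(L) ≤ 2^{(⌊log₂ m⌋+1) L}` (`#𝒱(L) ≤ (m+1)^L`, `m + 1 ≤ 2^{⌊log₂ m⌋+1}`). [folklore] -/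
theorem card_smallSets_le_two_pow (m L : ℕ) :
    #(smallSets (Fin m) L) ≤ 2 ^ ((Nat.log 2 m + 1) * L) := by
  have h : m + 1 ≤ 2 ^ (Nat.log 2 m + 1) := Nat.lt_pow_succ_log_self one_lt_two m
  have hV := card_smallSets_le (α := Fin m) L
  rw [Fintype.card_fin] at hV
  calc #(smallSets (Fin m) L) ≤ (m + 1) ^ L := hV
    _ ≤ (2 ^ (Nat.log 2 m + 1)) ^ L := Nat.pow_le_pow_left h _
    _ = 2 ^ ((Nat.log 2 m + 1) * L) := by rw [← pow_mul]

/-- **Positive budget from the planting base.** If `2 ν k C(l,2) ≤ m`, `t ≤ k ≤ m` and `4 m^{c+1} ≤ 2^t`, then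
`(ν C(l,2))^t C(m-t,k-t) ≤ ε C(m,k)` (`ε = epsOf c m`): multiply by `m^t`, use `C(m-t,k-t) m^t ≤ k^t C(m,k)` and
`(ν C(l,2) k)^t ≤ (m/2)^t ≤ ε m^t`. [folklore] -/
theorem pos_budget_of_base {c m l k ν t : ℕ} (hm : 1 ≤ m) (hν : 2 * ν * k * l.choose 2 ≤ m) (htk : t ≤ k)
    (hkm : k ≤ m) (h2t : 4 * m ^ (c + 1) ≤ 2 ^ t) :
    (((ν * l.choose 2) ^ t * (m - t).choose (k - t) : ℕ) : ℝ) ≤ epsOf c m * (m.choose k : ℝ) := by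
  have hmpos : (0 : ℝ) < m := by exact_mod_cast hm
  have hnat := choose_sub_mul_pow_le_pow_mul_choose t m k htk hkm
  have hreal : (((m - t).choose (k - t) : ℕ) : ℝ) * (m : ℝ) ^ t ≤ (k : ℝ) ^ t * (m.choose k : ℝ) := by
    exact_mod_cast hnat
  have hbase : (ν : ℝ) * ((l.choose 2 : ℕ) : ℝ) * (k : ℝ) ≤ (m : ℝ) / 2 := by
    rw [le_div_iff₀ two_pos]
    have : ((2 * ν * k * l.choose 2 : ℕ) : ℝ) ≤ (m : ℝ) := by exact_mod_cast hν
    push_cast at this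
    linarith
  have h2pow : (4 : ℝ) * (m : ℝ) ^ (c + 1) ≤ (2 : ℝ) ^ t := by exact_mod_cast h2t
  have hεt : ((m : ℝ) / 2) ^ t ≤ epsOf c m * (m : ℝ) ^ t := by
    rw [div_pow, epsOf_eq, one_div_mul_eq_div]
    exact div_le_div_of_nonneg_left (by positivity) (by positivity) h2pow
  have hmt : (0 : ℝ) < (m : ℝ) ^ t := pow_pos hmpos t
  refine le_of_mul_le_mul_right ?_ hmt
  have hcast : (((ν * l.choose 2) ^ t * (m - t).choose (k - t) : ℕ) : ℝ) =
      ((ν : ℝ) * ((l.choose 2 : ℕ) : ℝ)) ^ t * (((m - t).choose (k - t) : ℕ) : ℝ) := by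
    push_cast
    ring
  rw [hcast]
  calc ((ν : ℝ) * ((l.choose 2 : ℕ) : ℝ)) ^ t * (((m - t).choose (k - t) : ℕ) : ℝ) * (m : ℝ) ^ t
      = ((ν : ℝ) * ((l.choose 2 : ℕ) : ℝ)) ^ t * ((((m - t).choose (k - t) : ℕ) : ℝ) * (m : ℝ) ^ t) := by
        ring
    _ ≤ ((ν : ℝ) * ((l.choose 2 : ℕ) : ℝ)) ^ t * ((k : ℝ) ^ t * (m.choose k : ℝ)) :=
        mul_le_mul_of_nonneg_left hreal (by positivity)
    _ = ((ν : ℝ) * ((l.choose 2 : ℕ) : ℝ) * k) ^ t * (m.choose k : ℝ) := by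
        rw [mul_pow]
        ring
    _ ≤ ((m : ℝ) / 2) ^ t * (m.choose k : ℝ) :=
        mul_le_mul_of_nonneg_right (pow_le_pow_left₀ (by positivity) hbase t) (Nat.cast_nonneg _)
    _ ≤ epsOf c m * (m : ℝ) ^ t * (m.choose k : ℝ) := mul_le_mul_of_nonneg_right hεt (Nat.cast_nonneg _)
    _ = epsOf c m * (m.choose k : ℝ) * (m : ℝ) ^ t := by ring

/-- **Cover budget from a bit count.** If `V ≤ 2^a`, `a (E+1) + Λ (c+1) + 3 ≤ ν + 1` and `m ≤ 2^Λ` (`m ≥ 1`), then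
`V^E (1/2)^{ν+1} V ≤ 2^{-Λ(c+1)-3} < ε` (`ε = epsOf c m = 1/(4 m^{c+1})`). [folklore] -/
theorem cover_budget_of_bits {c m V a E Λ ν : ℕ} (hm : 1 ≤ m) (hV : V ≤ 2 ^ a)
    (hB : a * (E + 1) + (Λ * (c + 1) + 3) ≤ ν + 1) (hmΛ : m ≤ 2 ^ Λ) :
    (V : ℝ) ^ E * (1 / 2) ^ (ν + 1) * V < epsOf c m := by
  have hmpos : (0 : ℝ) < m := by exact_mod_cast hm
  have hVR : (V : ℝ) ≤ (2 : ℝ) ^ a := by exact_mod_cast hV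
  have hV0 : (0 : ℝ) ≤ (V : ℝ) := Nat.cast_nonneg _
  have hA : (V : ℝ) ^ E * V ≤ (2 : ℝ) ^ (a * (E + 1)) :=
    calc (V : ℝ) ^ E * V = (V : ℝ) ^ (E + 1) := (pow_succ _ _).symm
      _ ≤ ((2 : ℝ) ^ a) ^ (E + 1) := pow_le_pow_left₀ hV0 hVR _
      _ = (2 : ℝ) ^ (a * (E + 1)) := (pow_mul _ _ _).symm
  have hhalfpow : (1 / 2 : ℝ) ^ (ν + 1) ≤ (1 / 2) ^ (a * (E + 1) + (Λ * (c + 1) + 3)) :=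
    pow_le_pow_of_le_one (by norm_num) (by norm_num) hB
  have hm2 : (m : ℝ) ^ (c + 1) ≤ (2 : ℝ) ^ (Λ * (c + 1)) := by
    calc (m : ℝ) ^ (c + 1) ≤ ((2 ^ Λ : ℕ) : ℝ) ^ (c + 1) :=
          pow_le_pow_left₀ (Nat.cast_nonneg _) (by exact_mod_cast hmΛ) _
      _ = (2 : ℝ) ^ (Λ * (c + 1)) := by push_cast; rw [← pow_mul]
  have hpow2 : (0 : ℝ) < (2 : ℝ) ^ (Λ * (c + 1)) := by positivity
  calc (V : ℝ) ^ E * (1 / 2) ^ (ν + 1) * V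
      = (V : ℝ) ^ E * V * (1 / 2) ^ (ν + 1) := by ring
    _ ≤ (2 : ℝ) ^ (a * (E + 1)) * (1 / 2) ^ (a * (E + 1) + (Λ * (c + 1) + 3)) :=
        mul_le_mul hA hhalfpow (by positivity) (by positivity)
    _ = ((2 : ℝ) * (1 / 2)) ^ (a * (E + 1)) * (1 / 2) ^ (Λ * (c + 1) + 3) := by
        rw [pow_add, ← mul_assoc, ← mul_pow]
    _ = (1 / 2) ^ (Λ * (c + 1)) * (1 / 2) ^ 3 := by rw [pow_add]; norm_num
    _ = 1 / (8 * (2 : ℝ) ^ (Λ * (c + 1))) := by rw [one_div_pow, one_div_pow]; ring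
    _ < 1 / (4 * (2 : ℝ) ^ (Λ * (c + 1))) := by
        apply one_div_lt_one_div_of_lt (by positivity)
        linarith
    _ ≤ 1 / (4 * (m : ℝ) ^ (c + 1)) := by
        apply one_div_le_one_div_of_le (by positivity)
        linarith
    _ = epsOf c m := (epsOf_eq c m).symm

/-- **SG_PERM at logarithmic width, pointwise.** Let `m ≥ 1`, `4 log m ≤ k` (`k = kOf m`), `lOf m + 1 ≤ k`, let
`Λ = ⌊log₂ m⌋ + 1`, `L = (2c+8)Λ ≤ lOf m`, and let `ν` satisfy the planting base `2 ν k C(L,2) ≤ m` and the cover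
budget `Λ·L·(⌊log₂ d!⌋ + 1) + Λ(c+1) + 2 ≤ ν`. Then `SGAt m (PERM_d) L k (qOf m) (epsOf c m)`: the chain cover
`sgAt_perm_of_chain_budget` with `t = (c+4)Λ` — positive budget `pos_budget_of_base` (`4 m^{c+1} ≤ 2^t`), cover
budget `cover_budget_of_bits` (`#𝒱(L) ≤ 2^{ΛL}`, `m ≤ 2^Λ`). [folklore] -/
theorem sgAt_perm_logWidth_of_natBudget {c m d ν : ℕ} (hm : 1 ≤ m) (hLk : 4 * Real.log m ≤ (kOf m : ℝ))
    (hlk : lOf m + 1 ≤ kOf m) (hL : (2 * c + 8) * (Nat.log 2 m + 1) ≤ lOf m)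
    (hν : 2 * ν * kOf m * ((2 * c + 8) * (Nat.log 2 m + 1)).choose 2 ≤ m)
    (hB : (Nat.log 2 m + 1) * ((2 * c + 8) * (Nat.log 2 m + 1)) * (Nat.log 2 d.factorial + 1) +
      (Nat.log 2 m + 1) * (c + 1) + 2 ≤ ν) :
    SGAt m (IsPermGate d) ((2 * c + 8) * (Nat.log 2 m + 1)) (kOf m) (qOf m) (epsOf c m) := by
  have hq0 := qOf_nonneg hm hLk
  have hq1 := qOf_le_one m
  have hhalf : (1 / 2 : ℝ) ≤ qOf m ^ (((2 * c + 8) * (Nat.log 2 m + 1)).choose 2) :=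
    (half_le_qOf_pow hm hLk).trans (pow_le_pow_of_le_one hq0 hq1 (Nat.choose_le_choose 2 hL))
  have hmpos : (0 : ℝ) < m := by exact_mod_cast hm
  have hε : 0 < epsOf c m := by rw [epsOf_eq]; positivity
  have h2t : 2 * ((c + 4) * (Nat.log 2 m + 1)) ≤ (2 * c + 8) * (Nat.log 2 m + 1) := le_of_eq (by ring)
  have htk : (c + 4) * (Nat.log 2 m + 1) ≤ kOf m := by
    have : (c + 4) * (Nat.log 2 m + 1) ≤ (2 * c + 8) * (Nat.log 2 m + 1) := Nat.mul_le_mul_right _ (by omega)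
    omega
  refine sgAt_perm_of_chain_budget m _ (kOf m) d ν ((c + 4) * (Nat.log 2 m + 1)) (qOf m) (epsOf c m) hq0 hq1
    (by linarith) hε h2t (pos_budget_of_base hm hν htk (kOf_le_self m) (four_mul_pow_le_two_pow_logWidth c m)) ?_
  refine cover_budget_of_bits (a := (Nat.log 2 m + 1) * ((2 * c + 8) * (Nat.log 2 m + 1)))
    (Λ := Nat.log 2 m + 1) hm (card_smallSets_le_two_pow m _) ?_ (Nat.lt_pow_succ_log_self one_lt_two m).le
  have := hB
  omega

/-! ### The width `L(c,m)` is admissible, eventually -/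

/-- Eventually `(2c+8)(⌊log₂ m⌋+1) ≤ lOf m`: `(L+1)²(4 log₂ m + 1) ≤ 9 (6c+26)² (log m)³ ≤ (log m)⁴ ≤ m^{1/8} ≤ k` and
`lt_lOf_of_sq_mul_le`. [folklore] -/
theorem logWidth_le_lOf (c : ℕ) : ∀ᶠ m : ℕ in atTop, (2 * c + 8) * (Nat.log 2 m + 1) ≤ lOf m := by
  filter_upwards [eventually_ge_atTop 3, eventually_log_pow_four_le,
    eventually_le_log (9 * (6 * (c : ℝ) + 26) ^ 2)] with m hm h4 hK
  have hlog1 := one_le_log hm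
  have hc0 : (0 : ℝ) ≤ c := Nat.cast_nonneg c
  have hΛ : ((Nat.log 2 m : ℕ) : ℝ) ≤ 2 * Real.log m := natLog_two_le_two_mul_log m
  have hΛ' : (2 * (c : ℝ) + 8) * ((Nat.log 2 m : ℕ) : ℝ) ≤ (2 * (c : ℝ) + 8) * (2 * Real.log m) :=
    mul_le_mul_of_nonneg_left hΛ (by positivity)
  have hB1 : ((((2 * c + 8) * (Nat.log 2 m + 1) : ℕ) : ℝ)) + 1 ≤ (6 * (c : ℝ) + 26) * Real.log m := by
    push_cast
    nlinarith
  have hB0 : (0 : ℝ) ≤ ((((2 * c + 8) * (Nat.log 2 m + 1) : ℕ) : ℝ)) + 1 := by positivity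
  have hLle : 4 * Real.logb 2 m + 1 ≤ 9 * Real.log m := by
    have := logb_two_le_two_mul_log m
    linarith
  suffices h : ((((2 * c + 8) * (Nat.log 2 m + 1) : ℕ) : ℝ)) < lOf m by exact_mod_cast h.le
  refine lt_lOf_of_sq_mul_le ?_
  calc (((((2 * c + 8) * (Nat.log 2 m + 1) : ℕ) : ℝ)) + 1) ^ 2 * (4 * Real.logb 2 m + 1)
      ≤ ((6 * (c : ℝ) + 26) * Real.log m) ^ 2 * (9 * Real.log m) :=
        mul_le_mul (pow_le_pow_left₀ hB0 hB1 2) hLle (denom_pos m).le (by positivity)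
    _ = 9 * (6 * (c : ℝ) + 26) ^ 2 * Real.log m ^ 3 := by ring
    _ ≤ Real.log m * Real.log m ^ 3 := mul_le_mul_of_nonneg_right hK (by positivity)
    _ = Real.log m ^ 4 := by ring
    _ ≤ (m : ℝ) ^ (1 / 8 : ℝ) := h4
    _ = ((m : ℝ) ^ (1 / 16 : ℝ)) ^ 2 := (rpow_sixteenth_sq m).symm
    _ ≤ kOf m := sq_le_kOf m

/-- Eventually `(log₂ m)^5 ≤ m^{7/8}` (`(log x)^5 = o(x^{7/8})`, `log₂ m ≤ 2 log m`). [folklore] -/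
theorem eventually_logb_pow_five_le : ∀ᶠ m : ℕ in atTop, Real.logb 2 m ^ 5 ≤ (m : ℝ) ^ (7 / 8 : ℝ) := by
  have h := ((isLittleO_log_rpow_rpow_atTop (5 : ℝ) (by norm_num : (0 : ℝ) < 7 / 8)).comp_tendsto
    tendsto_natCast_atTop_atTop).def (by norm_num : (0 : ℝ) < 1 / 32)
  filter_upwards [h] with m hm
  have hl0 : 0 ≤ Real.log m := Real.log_natCast_nonneg m
  have h1 : ‖Real.log m ^ (5 : ℝ)‖ = Real.log m ^ 5 := by
    rw [Real.rpow_ofNat, Real.norm_of_nonneg (pow_nonneg hl0 5)]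
  have h2 : ‖(m : ℝ) ^ (7 / 8 : ℝ)‖ = (m : ℝ) ^ (7 / 8 : ℝ) :=
    Real.norm_of_nonneg (Real.rpow_nonneg (Nat.cast_nonneg m) _)
  simp only [Function.comp_def] at hm
  rw [h1, h2] at hm
  have hlb : Real.logb 2 m ≤ 2 * Real.log m := logb_two_le_two_mul_log m
  calc Real.logb 2 m ^ 5 ≤ (2 * Real.log m) ^ 5 := pow_le_pow_left₀ (logb_two_nonneg m) hlb 5
    _ = 32 * Real.log m ^ 5 := by ring
    _ ≤ 32 * (1 / 32 * (m : ℝ) ^ (7 / 8 : ℝ)) := by linarith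
    _ = (m : ℝ) ^ (7 / 8 : ℝ) := by ring

/-- `m^{1/8} · m^{7/8} = m`. [folklore] -/
theorem rpow_eighth_mul_rpow_seven_eighths (m : ℕ) : (m : ℝ) ^ (1 / 8 : ℝ) * (m : ℝ) ^ (7 / 8 : ℝ) = m := by
  rw [← Real.rpow_add' (Nat.cast_nonneg m) (by norm_num)]; norm_num

/-- **The budget algebra (abstract reals).** If `ℓ ≥ 576 (c+4)³`, `ℓ⁵ ≤ y`, `Λ ≤ 2ℓ`, `L ≤ 4(c+4)ℓ`,
`C ≤ 8(c+4)²ℓ²`, `k ≤ 2s` and `E ≤ y/ℓ⁵` (all quantities non-negative), then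
`(Λ L (E+1) + Λ(c+1) + 2)(2kC) ≤ 576 (c+4)³ s y/ℓ ≤ s y`. [folklore] -/
theorem logWidth_budget_algebra {c ℓ s y Λ L C k E : ℝ} (hc0 : 0 ≤ c) (hℓ : 576 * (c + 4) ^ 3 ≤ ℓ)
    (hs0 : 0 ≤ s) (hy5 : ℓ ^ 5 ≤ y) (hΛ : Λ ≤ 2 * ℓ) (hΛ0 : 0 ≤ Λ) (hL : L ≤ 4 * (c + 4) * ℓ) (hL0 : 0 ≤ L)
    (hC : C ≤ 8 * (c + 4) ^ 2 * ℓ ^ 2) (hC0 : 0 ≤ C) (hk : k ≤ 2 * s) (hk0 : 0 ≤ k) (hE : E ≤ y / ℓ ^ 5)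
    (hE0 : 0 ≤ E) : (Λ * L * (E + 1) + Λ * (c + 1) + 2) * (2 * k * C) ≤ s * y := by
  have hc4 : (64 : ℝ) ≤ (c + 4) ^ 3 := by
    have h := pow_le_pow_left₀ (by norm_num : (0 : ℝ) ≤ 4) (by linarith : (4 : ℝ) ≤ c + 4) 3
    linarith [show ((4 : ℝ)) ^ 3 = 64 by norm_num]
  have hℓ1 : (1 : ℝ) ≤ ℓ := by nlinarith
  have hℓ0 : (0 : ℝ) < ℓ := by linarith
  have hℓ5 : (0 : ℝ) < ℓ ^ 5 := pow_pos hℓ0 5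
  have hy0 : 0 < y := lt_of_lt_of_le hℓ5 hy5
  set β := y / ℓ ^ 5 with hβ
  have hβ1 : 1 ≤ β := by rwa [hβ, le_div_iff₀ hℓ5, one_mul]
  have hβ0 : 0 ≤ β := by linarith
  have hX : Λ * L * (E + 1) + Λ * (c + 1) + 2 ≤ 18 * (c + 4) * ℓ ^ 2 * β := by
    have h1 : Λ * L * (E + 1) ≤ (2 * ℓ) * (4 * (c + 4) * ℓ) * (2 * β) :=
      mul_le_mul (mul_le_mul hΛ hL hL0 (by positivity)) (by linarith) (by linarith) (by positivity)
    have h2 : Λ * (c + 1) + 2 ≤ 2 * (c + 4) * ℓ ^ 2 * β := by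
      have h21 : Λ * (c + 1) + 2 ≤ 2 * ℓ * (c + 1) + 2 * ℓ := by nlinarith
      have h23 : ℓ ≤ ℓ ^ 2 * β := by nlinarith
      nlinarith
    nlinarith
  have hN : 2 * k * C ≤ 32 * (c + 4) ^ 2 * s * ℓ ^ 2 := by
    calc 2 * k * C ≤ 2 * (2 * s) * (8 * (c + 4) ^ 2 * ℓ ^ 2) :=
          mul_le_mul (mul_le_mul_of_nonneg_left hk (by norm_num)) hC hC0 (by positivity)
      _ = 32 * (c + 4) ^ 2 * s * ℓ ^ 2 := by ring
  have h18 : (0 : ℝ) ≤ 18 * (c + 4) * ℓ ^ 2 * β := by positivity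
  calc (Λ * L * (E + 1) + Λ * (c + 1) + 2) * (2 * k * C)
      ≤ (18 * (c + 4) * ℓ ^ 2 * β) * (32 * (c + 4) ^ 2 * s * ℓ ^ 2) :=
        mul_le_mul hX hN (by positivity) h18
    _ = 576 * (c + 4) ^ 3 * (s * y) / ℓ := by
        rw [hβ]
        field_simp
        ring
    _ ≤ ℓ * (s * y) / ℓ := by
        apply div_le_div_of_nonneg_right _ hℓ0.le
        exact mul_le_mul_of_nonneg_right hℓ (mul_nonneg hs0 hy0.le)
    _ = s * y := by field_simp

/-- **The analytic conversion of the budgets (registered auxiliary statement).** For every `c`, eventually in `m`: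
the dense regime holds, `L = (2c+8)(⌊log₂ m⌋+1) ≤ lOf m`, and for every `d` with `d log₂ d ≤ m^{7/8}/(log₂ m)^5`
the bit budget `(Λ·L·(⌊log₂ d!⌋+1) + Λ(c+1) + 2) · (2 k C(L,2)) ≤ m` holds (`Λ = ⌊log₂ m⌋+1`, `k = kOf m`):
`Λ ≤ 2 log₂ m`, `L ≤ 4(c+4) log₂ m`, `C(L,2) ≤ 8(c+4)² log₂² m`, `k ≤ 2 m^{1/8}`, `⌊log₂ d!⌋ ≤ d log₂ d`, so the left side
is `≤ 576 (c+4)³ m / log₂ m ≤ m` once `log₂ m ≥ 576 (c+4)³` (`logWidth_budget_algebra`). [folklore] -/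
theorem logWidthPerm_regime : ∀ c : ℕ, ∀ᶠ m : ℕ in atTop, 4 ≤ m ∧ 16 * Real.log m ≤ (m : ℝ) ^ (1 / 16 : ℝ) ∧
    (c : ℝ) + 3 ≤ (m : ℝ) ^ (1 / 16 : ℝ) ∧ (2 * c + 8) * (Nat.log 2 m + 1) ≤ lOf m ∧
    ∀ d : ℕ, (d : ℝ) * Real.logb 2 d ≤ (m : ℝ) ^ (7 / 8 : ℝ) / Real.logb 2 m ^ 5 →
      ((Nat.log 2 m + 1) * ((2 * c + 8) * (Nat.log 2 m + 1)) * (Nat.log 2 d.factorial + 1) +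
        (Nat.log 2 m + 1) * (c + 1) + 2) * (2 * kOf m * ((2 * c + 8) * (Nat.log 2 m + 1)).choose 2) ≤ m := by
  intro c
  filter_upwards [denseRegime_params c, logWidth_le_lOf c, eventually_logb_pow_five_le,
    ((Real.tendsto_logb_atTop one_lt_two).comp tendsto_natCast_atTop_atTop).eventually_ge_atTop
      (576 * ((c : ℝ) + 4) ^ 3)] with m ⟨hm4, hL16, hc3, _⟩ hLl h5 hbig
  refine ⟨hm4, hL16, hc3, hLl, fun d hd => ?_⟩
  have hm1 : 1 ≤ m := by omega
  have hc0 : (0 : ℝ) ≤ c := Nat.cast_nonneg c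
  have hbig' : 576 * ((c : ℝ) + 4) ^ 3 ≤ Real.logb 2 m := by simpa [Function.comp_def] using hbig
  have hc4 : (64 : ℝ) ≤ ((c : ℝ) + 4) ^ 3 := by
    have h := pow_le_pow_left₀ (by norm_num : (0 : ℝ) ≤ 4) (by linarith : (4 : ℝ) ≤ (c : ℝ) + 4) 3
    linarith [show ((4 : ℝ)) ^ 3 = 64 by norm_num]
  have hℓ1 : (1 : ℝ) ≤ Real.logb 2 m := by nlinarith
  -- atomic bounds, in `push_cast` normal form
  have hΛ : (Nat.log 2 m : ℝ) + 1 ≤ 2 * Real.logb 2 m := by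
    have h := Real.natLog_le_logb m 2
    push_cast at h; linarith
  have hΛ0 : (0 : ℝ) ≤ (Nat.log 2 m : ℝ) + 1 := by linarith [(Nat.cast_nonneg _ : (0 : ℝ) ≤ (Nat.log 2 m : ℝ))]
  have hL : (2 * (c : ℝ) + 8) * ((Nat.log 2 m : ℝ) + 1) ≤ 4 * ((c : ℝ) + 4) * Real.logb 2 m := by nlinarith
  have hL0 : (0 : ℝ) ≤ (2 * (c : ℝ) + 8) * ((Nat.log 2 m : ℝ) + 1) := mul_nonneg (by linarith) hΛ0
  have hC : (((((2 * c + 8) * (Nat.log 2 m + 1)).choose 2 : ℕ) : ℝ)) ≤ 8 * ((c : ℝ) + 4) ^ 2 * Real.logb 2 m ^ 2 := by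
    rw [Nat.cast_choose_two]
    have hcast : ((((2 * c + 8) * (Nat.log 2 m + 1) : ℕ) : ℝ)) = (2 * (c : ℝ) + 8) * ((Nat.log 2 m : ℝ) + 1) := by
      push_cast; ring
    rw [hcast]
    have hsq : ((2 * (c : ℝ) + 8) * ((Nat.log 2 m : ℝ) + 1)) ^ 2 ≤ (4 * ((c : ℝ) + 4) * Real.logb 2 m) ^ 2 :=
      pow_le_pow_left₀ hL0 hL 2
    nlinarith
  have hC0 : (0 : ℝ) ≤ (((((2 * c + 8) * (Nat.log 2 m + 1)).choose 2 : ℕ) : ℝ)) := Nat.cast_nonneg _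
  have hk : (kOf m : ℝ) ≤ 2 * (m : ℝ) ^ (1 / 8 : ℝ) := by
    have := kOf_le_two_mul_sq hm1
    rwa [rpow_sixteenth_sq] at this
  have hk0 : (0 : ℝ) ≤ (kOf m : ℝ) := Nat.cast_nonneg _
  have hE : (Nat.log 2 d.factorial : ℝ) ≤ (m : ℝ) ^ (7 / 8 : ℝ) / Real.logb 2 m ^ 5 :=
    (natLog_factorial_le d).trans hd
  have hE0 : (0 : ℝ) ≤ (Nat.log 2 d.factorial : ℝ) := Nat.cast_nonneg _
  have hs0 : (0 : ℝ) ≤ (m : ℝ) ^ (1 / 8 : ℝ) := Real.rpow_nonneg (Nat.cast_nonneg m) _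
  have key := logWidth_budget_algebra hc0 hbig' hs0 h5 hΛ hΛ0 hL hL0 hC hC0 hk hk0 hE hE0
  rw [rpow_eighth_mul_rpow_seven_eighths] at key
  exact_mod_cast key

/-! ### SG_PERM at logarithmic width for all `d log₂ d ≤ m^{7/8}/(log₂ m)^5` -/

/-- **SG_PERM at logarithmic width (registered statement).** For every `c`, eventually in `m`, for EVERY `d` with
`d · log₂ d ≤ m^{7/8}/(log₂ m)^5`: `SGAt m (PERM_d) L (kOf m) (qOf m) (epsOf c m)` at the width
`L = (2c+8)(⌊log₂ m⌋+1)` — every `PERM_d` term gate over `≤ L`-atoms (nonabelian included, any fan-in) is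
`ε`-approximated one-sidedly by a small-clique DNF on (bare `⌈m^{1/8}⌉`-cliques) × `G(m, qOf m)`. Range of the PERM door:
`m^{11/16-o(1)}` (`sgAt_perm_of_dim_le_rpow`, width `lOf m`) → `m^{7/8-o(1)}`. Proof: `sgAt_perm_logWidth_of_natBudget`
with `ν = ⌊m/(2 k C(L,2))⌋`, budgets by `logWidthPerm_regime`. [folklore] -/
theorem sgAt_perm_logWidth : ∀ c : ℕ, ∀ᶠ m : ℕ in atTop, ∀ d : ℕ,
    (d : ℝ) * Real.logb 2 d ≤ (m : ℝ) ^ (7 / 8 : ℝ) / Real.logb 2 m ^ 5 →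
    SGAt m (IsPermGate d) ((2 * c + 8) * (Nat.log 2 m + 1)) (kOf m) (qOf m) (epsOf c m) := by
  intro c
  filter_upwards [logWidthPerm_regime c] with m ⟨hm4, hL16, hc3, hLl, hbud⟩ d hd
  have hm1 : 1 ≤ m := by omega
  have hx2 : (2 : ℝ) ≤ (m : ℝ) ^ (1 / 16 : ℝ) := by
    have : (0 : ℝ) ≤ c := Nat.cast_nonneg c
    linarith
  have hLk := four_mul_log_le_kOf hm1 hL16
  have hlk := lOf_add_one_le_kOf hx2
  have hn : 0 < 2 * kOf m * ((2 * c + 8) * (Nat.log 2 m + 1)).choose 2 := by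
    have hk : 0 < kOf m := by omega
    have hL2 : 2 ≤ (2 * c + 8) * (Nat.log 2 m + 1) := le_trans (by omega) (Nat.le_mul_of_pos_right _ (by omega))
    have hC : 0 < ((2 * c + 8) * (Nat.log 2 m + 1)).choose 2 := Nat.choose_pos hL2
    positivity
  refine sgAt_perm_logWidth_of_natBudget (ν := m / (2 * kOf m * ((2 * c + 8) * (Nat.log 2 m + 1)).choose 2))
    hm1 hLk hlk hLl ?_ ?_
  · calc 2 * (m / (2 * kOf m * ((2 * c + 8) * (Nat.log 2 m + 1)).choose 2)) * kOf m *
          ((2 * c + 8) * (Nat.log 2 m + 1)).choose 2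
        = m / (2 * kOf m * ((2 * c + 8) * (Nat.log 2 m + 1)).choose 2) *
            (2 * kOf m * ((2 * c + 8) * (Nat.log 2 m + 1)).choose 2) := by ring
      _ ≤ m := Nat.div_mul_le_self m _
  · rw [Nat.le_div_iff_mul_le hn]
    exact hbud d hd

/-- **SG_PERM at logarithmic width for all `d ≤ m^{3/4}`** (then `d log₂ d ≤ (3/4) m^{3/4} log₂ m ≤ m^{7/8}/(log₂ m)^5`
eventually). [folklore] -/
theorem sgAt_perm_logWidth_of_le_rpow : ∀ c : ℕ, ∀ᶠ m : ℕ in atTop, ∀ d : ℕ, (d : ℝ) ≤ (m : ℝ) ^ (3 / 4 : ℝ) →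
    SGAt m (IsPermGate d) ((2 * c + 8) * (Nat.log 2 m + 1)) (kOf m) (qOf m) (epsOf c m) := by
  intro c
  have h6 : ∀ᶠ m : ℕ in atTop, Real.logb 2 m ^ 6 ≤ (m : ℝ) ^ (1 / 8 : ℝ) := by
    have h := ((isLittleO_log_rpow_rpow_atTop (6 : ℝ) (by norm_num : (0 : ℝ) < 1 / 8)).comp_tendsto
      tendsto_natCast_atTop_atTop).def (by norm_num : (0 : ℝ) < 1 / 64)
    filter_upwards [h] with m hm
    have hl0 : 0 ≤ Real.log m := Real.log_natCast_nonneg m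
    have h1 : ‖Real.log m ^ (6 : ℝ)‖ = Real.log m ^ 6 := by
      rw [Real.rpow_ofNat, Real.norm_of_nonneg (pow_nonneg hl0 6)]
    have h2 : ‖(m : ℝ) ^ (1 / 8 : ℝ)‖ = (m : ℝ) ^ (1 / 8 : ℝ) :=
      Real.norm_of_nonneg (Real.rpow_nonneg (Nat.cast_nonneg m) _)
    simp only [Function.comp_def] at hm
    rw [h1, h2] at hm
    have hlb : Real.logb 2 m ≤ 2 * Real.log m := logb_two_le_two_mul_log m
    calc Real.logb 2 m ^ 6 ≤ (2 * Real.log m) ^ 6 := pow_le_pow_left₀ (logb_two_nonneg m) hlb 6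
      _ = 64 * Real.log m ^ 6 := by ring
      _ ≤ 64 * (1 / 64 * (m : ℝ) ^ (1 / 8 : ℝ)) := by linarith
      _ = (m : ℝ) ^ (1 / 8 : ℝ) := by ring
  filter_upwards [sgAt_perm_logWidth c, h6, eventually_ge_atTop 3] with m hm h6m hm3 d hd
  apply hm d
  have hmpos : (0 : ℝ) < m := by exact_mod_cast (show 0 < m by omega)
  have hℓ1 : 1 ≤ Real.logb 2 m := (one_le_log hm3).trans (log_le_logb_two m)
  have h34 : (0 : ℝ) ≤ (m : ℝ) ^ (3 / 4 : ℝ) := Real.rpow_nonneg (Nat.cast_nonneg m) _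
  have hprod : (m : ℝ) ^ (3 / 4 : ℝ) * (m : ℝ) ^ (1 / 8 : ℝ) = (m : ℝ) ^ (7 / 8 : ℝ) := by
    rw [← Real.rpow_add' (Nat.cast_nonneg m) (by norm_num)]
    norm_num
  have hstep : (d : ℝ) * Real.logb 2 d ≤ (m : ℝ) ^ (3 / 4 : ℝ) * Real.logb 2 m := by
    rcases Nat.eq_zero_or_pos d with rfl | hdpos
    · simp only [Nat.cast_zero, zero_mul]
      exact mul_nonneg h34 (by linarith)
    · have hd0 : (0 : ℝ) < d := by exact_mod_cast hdpos
      have hlogd : Real.logb 2 d ≤ Real.logb 2 m := by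
        calc Real.logb 2 d ≤ Real.logb 2 ((m : ℝ) ^ (3 / 4 : ℝ)) := Real.logb_le_logb_of_le one_lt_two hd0 hd
          _ = 3 / 4 * Real.logb 2 m := Real.logb_rpow_eq_mul_logb_of_pos hmpos
          _ ≤ Real.logb 2 m := by linarith
      have hlogd0 : 0 ≤ Real.logb 2 d := Real.logb_nonneg one_lt_two (by exact_mod_cast hdpos)
      exact mul_le_mul hd hlogd hlogd0 h34
  calc (d : ℝ) * Real.logb 2 d ≤ (m : ℝ) ^ (3 / 4 : ℝ) * Real.logb 2 m := hstep
    _ ≤ (m : ℝ) ^ (7 / 8 : ℝ) / Real.logb 2 m ^ 5 := by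
        rw [le_div_iff₀ (by positivity), ← hprod]
        calc (m : ℝ) ^ (3 / 4 : ℝ) * Real.logb 2 m * Real.logb 2 m ^ 5
            = (m : ℝ) ^ (3 / 4 : ℝ) * Real.logb 2 m ^ 6 := by ring
          _ ≤ (m : ℝ) ^ (3 / 4 : ℝ) * (m : ℝ) ^ (1 / 8 : ℝ) := mul_le_mul_of_nonneg_left h6m h34

end Summit.PneNP.PneNP.Theorems

end
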